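import Summits.ValiantsHypothesis.ValiantsHypothesis.Theses.FermionizationDimension
import Literature.Computability.AlgebraicComplexity.PermanentIrreducible
import Literature.Computability.AlgebraicComplexity.FermionicPencil

/-!
# Route FermionizationDimension — `TwistedDeterminantFormula`

Closes item stmt-ValiantsHypothesis-7289 (support, rank 9) of route
`route-ValiantsHypothesis-FermionizationDimension`: the semantics of the commutative twisting
("fermionization") model. If `R` is a commutative `ℂ`-algebra, `u : Fin n → Fin n → R` and
`ℓ : R →ₗ[ℂ] ℂ` satisfy `ℓ (∏ i, u (σ i) i) = sgn σ` for every permutation `σ`, then applying `ℓ`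
coefficientwise to the determinant over `R[x]` of the Hadamard-twisted generic matrix
`(x_{ij} · u_{ij})` gives the generic permanent `per_n(x)`:

* `det = ∑_σ sgn σ ∏_i M_{σ i, i}` (`Matrix.det_apply'`), and each transversal product of the
  twisted matrix is `C (∏_i u_{σ i, i}) · ∏_i x_{σ i, i} = monomial μ_σ (∏_i u_{σ i, i})` with
  `μ_σ = permMonomial σ = ∑_i e_{(σ i, i)}` (`prod_X_perm_eq_monomial` of
  `Literature.Computability.AlgebraicComplexity.FermionicPencil`; `det_twistedX_eq_sum_monomial`);
* hence the `m`-th coefficient of the twisted determinant is `∑_{σ : μ_σ = m} sgn σ · ∏_i u_{σ i, i}`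
  (`coeff_det_twistedX`), whose image under `ℓ` is `∑_{σ : μ_σ = m} (sgn σ)² = #{σ : μ_σ = m}`,
  the `m`-th coefficient of `per_n = ∑_σ x^{μ_σ}` (`coeff_perPoly` of
  `Literature.Computability.AlgebraicComplexity.PermanentIrreducible`).

(Marcus–Minc 1961; Bürgisser 2000, (2.1)–(2.2).) Pure bookkeeping over Mathlib's `Matrix.det` and
`MvPolynomial.coeff` and the tree's `permMonomial` / `coeff_perPoly` / `prod_X_perm_eq_monomial`.
-/

namespace Summit.ValiantsHypothesis.Theorems

open MvPolynomial Literature.Computability.AlgebraicComplexity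

/-- Leibniz expansion of the Hadamard-twisted generic determinant over `R[x]`:
`det (x_{ij} · u_{ij}) = ∑_σ (sgn σ · ∏_i u_{σ i, i}) · x^{μ_σ}` with `μ_σ = permMonomial σ`
(Bürgisser 2000, (2.1), with entries twisted by `u ∈ R^{n×n}`). [folklore] -/
theorem det_twistedX_eq_sum_monomial {n : Type*} [Fintype n] [DecidableEq n] (R : Type*)
    [CommRing R] (u : n → n → R) :
    Matrix.det (Matrix.of fun i j : n => (X (i, j) : MvPolynomial (n × n) R) * C (u i j)) =
      ∑ σ : Equiv.Perm n,
        monomial (permMonomial σ) ((Equiv.Perm.sign σ : ℤ) • ∏ i, u (σ i) i) := by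
  rw [Matrix.det_apply']
  refine Finset.sum_congr rfl fun σ _ => ?_
  simp only [Matrix.of_apply, permMonomial]
  rw [Finset.prod_mul_distrib, ← map_prod C, prod_X_perm_eq_monomial, zsmul_eq_mul,
    ← map_intCast (C : R →+* MvPolynomial (n × n) R), mul_comm (monomial _ _) (C _), ← mul_assoc,
    ← map_mul, C_mul_monomial, mul_one]

/-- Coefficients of the Hadamard-twisted generic determinant:
`coeff m (det (x_{ij} · u_{ij})) = ∑_{σ : μ_σ = m} sgn σ · ∏_i u_{σ i, i}` (at most one `σ`
contributes, `permMonomial` being injective). [folklore] -/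
theorem coeff_det_twistedX {n : Type*} [Fintype n] [DecidableEq n] (R : Type*) [CommRing R]
    (u : n → n → R) (m : (n × n) →₀ ℕ) :
    coeff m (Matrix.det (Matrix.of fun i j : n =>
        (X (i, j) : MvPolynomial (n × n) R) * C (u i j))) =
      ∑ σ : Equiv.Perm n,
        if permMonomial σ = m then (Equiv.Perm.sign σ : ℤ) • ∏ i, u (σ i) i else 0 := by
  rw [det_twistedX_eq_sum_monomial, coeff_sum]
  simp only [coeff_monomial]

/-- Settles item stmt-ValiantsHypothesis-7289 (`TwistedDeterminantFormula`, route
FermionizationDimension): if `ℓ (∏_i u_{σ i, i}) = sgn σ` for all `σ ∈ S_n`, then coefficient by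
coefficient `ℓ (det_{R[x]} (x_{ij} · u_{ij})) = per_n(x)` — each transversal of the twisted matrix
contributes `sgn σ · ℓ (∏_i u_{σ i, i}) = (sgn σ)² = 1` at its own permutation monomial `x^{μ_σ}`,
exactly the coefficient pattern of `per_n = ∑_σ x^{μ_σ}` (Marcus–Minc 1961; Bürgisser 2000,
(2.1)–(2.2)). -/
theorem twistedDeterminantFormula_proof :
    Summit.ValiantsHypothesis.ValiantsHypothesis.Theses.FermionizationDimension.TwistedDeterminantFormula := by
  unfold Summit.ValiantsHypothesis.ValiantsHypothesis.Theses.FermionizationDimension.TwistedDeterminantFormula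
  intro n R _ _ u ℓ hℓ m
  rw [coeff_det_twistedX, coeff_perPoly, map_sum]
  refine Finset.sum_congr rfl (fun σ _ => ?_)
  split_ifs with h
  · rw [map_zsmul, hℓ σ, zsmul_eq_mul, ← Int.cast_mul, Int.units_coe_mul_self, Int.cast_one]
  · exact map_zero ℓ

end Summit.ValiantsHypothesis.Theorems
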